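import Summits.Ventures.Crystal3D.Theorems.StickyWulffConstantTextureLiminfTexShadowWeakZigSplit
import Summits.Ventures.Crystal3D.Theorems.StickyWulffConstantTextureLiminfTexShadowDeficitMinDefs
import Summits.Ventures.Crystal3D.Theorems.StickyWulffConstantTextureLiminfTexShadowWalkerCoveredGlue
import Summits.Ventures.Crystal3D.Theorems.StickyWulffConstantTextureLiminfTexShadowFamCoaxialAssembly
import Summits.Ventures.Crystal3D.Theorems.StickyWulffConstantTextureLiminfTexShadowFamilyCoaxial
import HarnessLib

/-!
# TexShadow at ONE plate thickness: the `At R₀` glue (v6.20, cf-p1 DECISION (lxvii): T fixes `R₀ := 10`)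

HONEST FRAMING. Venture `Summits/Ventures/Crystal3D` (cell `crystal3d-full`), helper `--supports` the crux `TextureLiminf`
(stmt-Ventures-19483) of `route-Ventures-StickyWulffConstant`, registered line `TexShadow`.  Pure bookkeeping (census-free, standard
axioms); F-C1 not moved; nothing about the open stubs is claimed.  cf-p1 (lxvii) (2026-08-29T00:13:52Z): «T consumes every wall law at
ONE common thickness R₀ := 10» — `BilayerWall` itself is `∃ C R₀, …`, so the texture needs each partial law at a single `R₀`; the
`…From R` forms (`∀ R₀ ≥ R, ∃ C`) of v6.4–v6.19 were typed to mirror lane G's items, not from need, and lane F's uniform law F-U is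
only available at the literal `R₀ = 10` (the restatement programme, `…CoaxialWallLawLedgerWithDefs`).  This file re-derives the
skeleton's glue theorems AT a fixed `R₀` (proof bodies = the `From` versions' bodies after their `obtain` preambles, verbatim):

* `bilayerWallOnReachWeakZig_of_zigSplitAt`, `bilayerWallOnReachAll_of_splitAt`, `bilayerWallOnReachAll_of_classesAt` (closed parts
  row-covered / zig-frames-apart instantiated at any `R₀ ≥ 6`), `bilayerWallWalkerCoveredAt_of_F4` (`R₀ ≥ 6`),
  `bilayerWallGeneric_of_four_minAt`, `bilayerWall_of_splitAt`;
* the family-class dispatcher and the Deficit-MIN pool at fixed thickness: `famCoaxialAt_of_dispatch` (`R₀ ≥ 10`),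
  `famSharedAt_of_famCoaxialAt`, `famTwinAt_of_famCoaxialAt`, `bilayerWallDeficitMinAt_of_pool` (`R₀ ≥ 3`);
* **`bilayerWall_of_stubsAt`**: the whole v6.20 composition at one `R₀ ≥ 10` from the seven open inputs
  (`E1`-data, F-U, (β-iii), T-F2 (two keys), the h-strip payer pool, the residual).

v6.20 STUB TEXTS (all at `R₀ = 10`): `stub_coaxialUnif : ∃ C, CoaxialUnifAt C 10`, `stub_betaIII : ∃ C, BilayerWallBetaIII C 10`,
`stub_famFaulted : (∃ C, BilayerWallFaultedOnReachCoaxial C 10) ∧ (∃ C, BilayerWallFaultedZigCoaxial C 10)`,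
`stub_hStripPayerPool : ∃ C, HStripPayerPool C 10`, `stub_bilayerWallResidual : ∃ C, BilayerWallResidual C 10`.
-/

noncomputable section

namespace Summit.Ventures.Crystal3D.Cruxes.TextureLiminf.TexShadow

open Summit.Ventures.Crystal3D Summit.Ventures.Crystal3D.Theorems Finset TentCertificate
open Literature.MathematicalPhysics.StatisticalMechanics (IsHaggSeq constHagg isHaggSeq_const fccStacking basalMirror)
open scoped InnerProductSpace

/-! ## On-reach glue at one thickness -/

/-- **Zig-frames-apart ∪ ZO1 ∪ ZO2 ∪ ZO3 ⇒ W, at one `R₀ ≥ 0`.** -/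
theorem bilayerWallOnReachWeakZig_of_zigSplitAt {R₀ C₁ C₂ C₃ C₄ : ℝ} (hR₀0 : 0 ≤ R₀)
    (hC₁ : BilayerWallZigFramesApart C₁ R₀) (hC₂ : BilayerWallZigShared C₂ R₀) (hC₃ : BilayerWallZigTwin C₃ R₀)
    (hC₄ : BilayerWallZigCoaxial C₄ R₀) :
    BilayerWallOnReachWeakZig (max (max C₁ C₂) (max C₃ C₄)) R₀ := by
  classical
  set C : ℝ := max (max C₁ C₂) (max C₃ C₄) with hCdef
  have e1 : C₁ ≤ C := (le_max_left _ _).trans (le_max_left _ _)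
  have e2 : C₂ ≤ C := (le_max_right _ _).trans (le_max_left _ _)
  have e3 : C₃ ≤ C := (le_max_left _ _).trans (le_max_right _ _)
  have e4 : C₄ ≤ C := (le_max_right _ _).trans (le_max_right _ _)
  intro σ₁ σ₂ hσ₁ hσ₂ L₁ L₂ s₁ s₂ A₁ A₂ u₁ u₂ hu₁ hu₂ hgen c m hadm hΔ₁ hΔ₂ hFD hBOR hRow hZG
  by_cases hZA : ZigFramesApart L₁ s₁ σ₁ L₂ s₂ σ₂
  · exact bilayerWallAt_mono hR₀0 e1 (hC₁ σ₁ σ₂ hσ₁ hσ₂ L₁ L₂ s₁ s₂ A₁ A₂ u₁ u₂ hu₁ hu₂ hgen hΔ₁ hΔ₂ hZA c m hadm hFD)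
  · rcases zigFrameClasses_of_not_zigFramesApart hZA with h | h | h
    · exact bilayerWallAt_mono hR₀0 e2
        (hC₂ σ₁ σ₂ hσ₁ hσ₂ L₁ L₂ s₁ s₂ A₁ A₂ u₁ u₂ hu₁ hu₂ hgen c m hadm hΔ₁ hΔ₂ hFD hBOR hRow hZG h)
    · exact bilayerWallAt_mono hR₀0 e3
        (hC₃ σ₁ σ₂ hσ₁ hσ₂ L₁ L₂ s₁ s₂ A₁ A₂ u₁ u₂ hu₁ hu₂ hgen c m hadm hΔ₁ hΔ₂ hFD hBOR hRow hZG h)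
    · exact bilayerWallAt_mono hR₀0 e4
        (hC₄ σ₁ σ₂ hσ₁ hσ₂ L₁ L₂ s₁ s₂ A₁ A₂ u₁ u₂ hu₁ hu₂ hgen c m hadm hΔ₁ hΔ₂ hFD hBOR hRow hZG h)

/-- **Row-covered ∪ zig-apart ∪ O1 ∪ O2 ∪ O3 ∪ W ⇒ on-reach-all at `OffR := FramesApart`, at one `R₀ ≥ 0`.** -/
theorem bilayerWallOnReachAll_of_splitAt {R₀ C₁ C₂ C₃ C₄ C₅ C₆ : ℝ} (hR₀0 : 0 ≤ R₀)
    (hC₁ : BilayerWallRowCov FramesApart C₁ R₀) (hC₂ : BilayerWallZigApart C₂ R₀)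
    (hC₃ : BilayerWallOnReachShared C₃ R₀) (hC₄ : BilayerWallOnReachTwin C₄ R₀)
    (hC₅ : BilayerWallOnReachCoaxial C₅ R₀) (hC₆ : BilayerWallOnReachWeakZig C₆ R₀) :
    BilayerWallOnReachAll FramesApart (max (max C₁ C₂) (max (max C₃ C₄) (max C₅ C₆))) R₀ := by
  classical
  set C : ℝ := max (max C₁ C₂) (max (max C₃ C₄) (max C₅ C₆)) with hCdef
  have e1 : C₁ ≤ C := le_trans (le_max_left _ _) (le_max_left _ _)
  have e2 : C₂ ≤ C := le_trans (le_max_right _ _) (le_max_left _ _)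
  have e3 : C₃ ≤ C := le_trans (le_trans (le_max_left _ _) (le_max_left _ _)) (le_max_right _ _)
  have e4 : C₄ ≤ C := le_trans (le_trans (le_max_right _ _) (le_max_left _ _)) (le_max_right _ _)
  have e5 : C₅ ≤ C := le_trans (le_trans (le_max_left _ _) (le_max_right _ _)) (le_max_right _ _)
  have e6 : C₆ ≤ C := le_trans (le_trans (le_max_right _ _) (le_max_right _ _)) (le_max_right _ _)
  intro σ₁ σ₂ hσ₁ hσ₂ L₁ L₂ s₁ s₂ A₁ A₂ u₁ u₂ hu₁ hu₂ hgen c m hadm H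
  -- the three frame classes, for a dominated table
  have classes : DomBy L₁ σ₁ L₂ σ₂ c → ¬ FramesApart L₁ s₁ σ₁ L₂ s₂ σ₂ → BilayerWallAt C R₀ σ₁ σ₂ L₁ L₂ s₁ s₂ c := by
    intro hdom hFA
    rcases frameClasses_of_not_framesApart hFA with h | h | h
    · exact bilayerWallAt_mono hR₀0 e3 (hC₃ σ₁ σ₂ hσ₁ hσ₂ L₁ L₂ s₁ s₂ A₁ A₂ u₁ u₂ hu₁ hu₂ hgen c m hadm hdom h)
    · exact bilayerWallAt_mono hR₀0 e4 (hC₄ σ₁ σ₂ hσ₁ hσ₂ L₁ L₂ s₁ s₂ A₁ A₂ u₁ u₂ hu₁ hu₂ hgen c m hadm hdom h)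
    · exact bilayerWallAt_mono hR₀0 e5 (hC₅ σ₁ σ₂ hσ₁ hσ₂ L₁ L₂ s₁ s₂ A₁ A₂ u₁ u₂ hu₁ hu₂ hgen c m hadm hdom h)
  by_cases hRow : RowMixDominated (Real.sqrt 2 / 2) L₁ σ₁ L₂ σ₂ c
  · by_cases hFA : FramesApart L₁ s₁ σ₁ L₂ s₂ σ₂
    · exact bilayerWallAt_mono hR₀0 e1 (hC₁ σ₁ σ₂ hσ₁ hσ₂ L₁ L₂ s₁ s₂ A₁ A₂ u₁ u₂ hu₁ hu₂ hgen c m hadm hRow hFA)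
    · exact classes (Or.inr hRow) hFA
  · rcases H with ⟨hS₁, hS₂, hFD, hBOR⟩ | ⟨hRow', -⟩
    · by_cases hZG : ZigGood L₁ σ₁ e₃ ∧ ZigGood L₂ σ₂ (-e₃)
      · by_cases hFA : FramesApart L₁ s₁ σ₁ L₂ s₂ σ₂
        · exact bilayerWallAt_mono hR₀0 e2
            (hC₂ σ₁ σ₂ hσ₁ hσ₂ L₁ L₂ s₁ s₂ A₁ A₂ u₁ u₂ hu₁ hu₂ hgen hZG.1 hZG.2 hFA c m hadm hFD)
        · exact classes (Or.inl ⟨hZG.1, hZG.2, hFD⟩) hFA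
      · exact bilayerWallAt_mono hR₀0 e6
          (hC₆ σ₁ σ₂ hσ₁ hσ₂ L₁ L₂ s₁ s₂ A₁ A₂ u₁ u₂ hu₁ hu₂ hgen c m hadm hS₁ hS₂ hFD hBOR hRow hZG)
    · exact absurd hRow' hRow

/-- **Walker-covered walls at any `R₀ ≥ 6`, modulo E1 / StarPairFar** (the `From 6` content of `bilayerWallWalkerCovered_of_F4`). -/
theorem bilayerWallWalkerCoveredAt_of_F4 {sE : E3} (hsE : sE ∈ fccSlots)
    (hcert : ExactOnly 0 (fccSlots.filter fun w => 0 < ⟪w, sE⟫_ℝ))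
    (hDS : ∀ F₁ F₂ : E3 ≃ₗᵢ[ℝ] E3, DoubleStarCoaxialAt F₁ F₂) (hCP : CapPairCoaxial) {R₀ : ℝ} (hR₀ : 6 ≤ R₀) :
    ∃ C : ℝ, BilayerWallWalkerCovered C R₀ := by
  refine bilayerWallWalkerCoveredFrom_of_orientedLineCounts 6 (by norm_num) ?_ R₀ hR₀
  intro R₁ hR₁
  exact ⟨318 + 192 * R₁, fun σ₁ σ₂ hσ₁ hσ₂ L₁ L₂ s₁ s₂ hax₁ hax₂ hst₁ hst₂ hO₁ hO₂ hO₃ =>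
    barlow_hlines_oriented hsE hcert hDS hCP hσ₁ hσ₂ L₁ L₂ s₁ s₂ hax₁ hax₂ hst₁ hst₂ hO₁ hO₂ hO₃ R₁ hR₁⟩

/-- **On-reach-all at one `R₀ ≥ 6` from the six registered-class inputs at that `R₀`**, the two closed parts (row-covered at
`FramesApart`, zig-frames-apart) discharged modulo E1 / StarPairFar. -/
theorem bilayerWallOnReachAll_of_classesAt
    {sE : E3} (hsE : sE ∈ fccSlots) (hcert : ExactOnly 0 (fccSlots.filter fun w => 0 < ⟪w, sE⟫_ℝ))
    (hDS : ∀ F₁ F₂ : E3 ≃ₗᵢ[ℝ] E3, DoubleStarCoaxialAt F₁ F₂) (hCP : CapPairCoaxial) {R₀ : ℝ} (hR₀ : 6 ≤ R₀)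
    (hS : ∃ C, BilayerWallOnReachShared C R₀) (hT : ∃ C, BilayerWallOnReachTwin C R₀) (hC : ∃ C, BilayerWallOnReachCoaxial C R₀)
    (hZS : ∃ C, BilayerWallZigShared C R₀) (hZT : ∃ C, BilayerWallZigTwin C R₀) (hZC : ∃ C, BilayerWallZigCoaxial C R₀) :
    ∃ C : ℝ, BilayerWallOnReachAll FramesApart C R₀ := by
  have hR₀0 : 0 ≤ R₀ := by linarith
  obtain ⟨C_R, hR⟩ := bilayerWallRowCovFrom_framesApart hsE hcert hDS hCP R₀ hR₀
  obtain ⟨C_A, hA⟩ := bilayerWallZigFramesApartFrom_of_cert hsE hcert hDS hCP R₀ hR₀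
  obtain ⟨C_S, hS⟩ := hS
  obtain ⟨C_T, hT⟩ := hT
  obtain ⟨C_C, hC⟩ := hC
  obtain ⟨C_ZS, hZS⟩ := hZS
  obtain ⟨C_ZT, hZT⟩ := hZT
  obtain ⟨C_ZC, hZC⟩ := hZC
  exact ⟨_, bilayerWallOnReachAll_of_splitAt hR₀0 hR (bilayerWallZigApart_of_zigFramesApart hA) hS hT hC
    (bilayerWallOnReachWeakZig_of_zigSplitAt hR₀0 hA hZS hZT hZC)⟩

/-! ## The generic glue and the wall law at one thickness -/

/-- **Zig-covered ∪ row-covered ∪ on-reach ∪ deficit-MIN ⇒ generic, at one `R₀ ≥ 0`** (`bilayerWallGeneric_of_four_min`'s body). -/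
theorem bilayerWallGeneric_of_four_minAt
    {OffR : (E3 ≃ₗᵢ[ℝ] E3) → E3 → (ℤ → ℤ) → (E3 ≃ₗᵢ[ℝ] E3) → E3 → (ℤ → ℤ) → Prop}
    {R₀ C₁ C₂ C₃ C₄ : ℝ} (hR₀0 : 0 ≤ R₀) (hC₁ : BilayerWallWalkerCovered C₁ R₀)
    (hC₂ : BilayerWallRowCov OffR C₂ R₀) (hC₃ : BilayerWallOnReachAll OffR C₃ R₀) (hC₄ : BilayerWallDeficitMin C₄ R₀) :
    BilayerWallGeneric (max (max C₁ C₂) (max C₃ C₄)) R₀ := by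
  classical
  have h2 : C₂ ≤ max (max C₁ C₂) (max C₃ C₄) := le_trans (le_max_right _ _) (le_max_left _ _)
  have h3 : C₃ ≤ max (max C₁ C₂) (max C₃ C₄) := le_trans (le_max_left _ _) (le_max_right _ _)
  intro σ₁ σ₂ hσ₁ hσ₂ L₁ L₂ s₁ s₂ A₁ A₂ u₁ u₂ hu₁ hu₂ hgen c m hadm
  -- the row-or-on-reach dichotomy, for a presentation whose table is row-mix-dominated
  by_cases hZ : DeltaSteep L₁ e₃ ∧ DeltaSteep L₂ (-e₃) ∧ FluxDominated (Real.sqrt 2 / 2) L₁ σ₁ L₂ σ₂ c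
  · by_cases hoff : BarlowOffReach L₁ s₁ σ₁ L₂ s₂ σ₂
    · exact bilayerWallAt_mono hR₀0 (le_trans (le_max_left _ _) (le_max_left _ _))
        (hC₁ σ₁ σ₂ hσ₁ hσ₂ L₁ L₂ s₁ s₂ A₁ A₂ u₁ u₂ hu₁ hu₂ hgen ⟨hZ.1, hZ.2.1, hoff⟩ c m hadm hZ.2.2)
    · exact bilayerWallAt_mono hR₀0 h3
        (hC₃ σ₁ σ₂ hσ₁ hσ₂ L₁ L₂ s₁ s₂ A₁ A₂ u₁ u₂ hu₁ hu₂ hgen c m hadm (Or.inl ⟨hZ.1, hZ.2.1, hZ.2.2, hoff⟩))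
  · by_cases hRow : RowMixDominated (Real.sqrt 2 / 2) L₁ σ₁ L₂ σ₂ c
    · by_cases hoff : OffR L₁ s₁ σ₁ L₂ s₂ σ₂
      · exact bilayerWallAt_mono hR₀0 h2 (hC₂ σ₁ σ₂ hσ₁ hσ₂ L₁ L₂ s₁ s₂ A₁ A₂ u₁ u₂ hu₁ hu₂ hgen c m hadm hRow hoff)
      · exact bilayerWallAt_mono hR₀0 h3
          (hC₃ σ₁ σ₂ hσ₁ hσ₂ L₁ L₂ s₁ s₂ A₁ A₂ u₁ u₂ hu₁ hu₂ hgen c m hadm (Or.inr ⟨hRow, hoff⟩))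
    · by_cases hRow₁ : RowMixDominated (Real.sqrt 2 / 2) (basalMirror.trans L₁) (fun n => -σ₁ (-n - 1)) L₂ σ₂
          (fun i j => c (-i - 1) j)
      · by_cases hoff : OffR (basalMirror.trans L₁) s₁ (fun n => -σ₁ (-n - 1)) L₂ s₂ σ₂
        · exact bilayerWallAt_mono hR₀0 h2 (rowCov_flip₁ hC₂ hσ₁ hσ₂ hu₁ hu₂ hgen hadm hRow₁ hoff)
        · exact bilayerWallAt_mono hR₀0 h3 (onReachAll_flip₁ hC₃ hσ₁ hσ₂ hu₁ hu₂ hgen hadm (Or.inr ⟨hRow₁, hoff⟩))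
      · by_cases hRow₂ : RowMixDominated (Real.sqrt 2 / 2) L₁ σ₁ (basalMirror.trans L₂) (fun n => -σ₂ (-n - 1))
            (fun i j => c i (-j - 1))
        · by_cases hoff : OffR L₁ s₁ σ₁ (basalMirror.trans L₂) s₂ (fun n => -σ₂ (-n - 1))
          · exact bilayerWallAt_mono hR₀0 h2 (rowCov_flip₂ hC₂ hσ₁ hσ₂ hu₁ hu₂ hgen hadm hRow₂ hoff)
          · exact bilayerWallAt_mono hR₀0 h3 (onReachAll_flip₂ hC₃ hσ₁ hσ₂ hu₁ hu₂ hgen hadm (Or.inr ⟨hRow₂, hoff⟩))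
        · by_cases hRow₁₂ : RowMixDominated (Real.sqrt 2 / 2) (basalMirror.trans L₁) (fun n => -σ₁ (-n - 1))
              (basalMirror.trans L₂) (fun n => -σ₂ (-n - 1)) (fun i j => c (-i - 1) (-j - 1))
          · by_cases hoff : OffR (basalMirror.trans L₁) s₁ (fun n => -σ₁ (-n - 1)) (basalMirror.trans L₂) s₂
                (fun n => -σ₂ (-n - 1))
            · exact bilayerWallAt_mono hR₀0 h2 (rowCov_flip₁₂ hC₂ hσ₁ hσ₂ hu₁ hu₂ hgen hadm hRow₁₂ hoff)
            · exact bilayerWallAt_mono hR₀0 h3 (onReachAll_flip₁₂ hC₃ hσ₁ hσ₂ hu₁ hu₂ hgen hadm (Or.inr ⟨hRow₁₂, hoff⟩))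
          · exact bilayerWallAt_mono hR₀0 (le_trans (le_max_right _ _) (le_max_right _ _))
              (hC₄ σ₁ σ₂ hσ₁ hσ₂ L₁ L₂ s₁ s₂ A₁ A₂ u₁ u₂ hu₁ hu₂ hgen c m hadm hZ hRow hRow₁ hRow₂ hRow₁₂)

/-- **Generic part + residual part at one `R₀ ≥ 1` ⇒ the wall law `BilayerWall`.** -/
theorem bilayerWall_of_splitAt {R₀ C₁ C₂ : ℝ} (hR₀1 : 1 ≤ R₀) (hC₁ : BilayerWallGeneric C₁ R₀)
    (hC₂ : BilayerWallResidual C₂ R₀) : BilayerWall := by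
  classical
  refine ⟨max C₁ C₂, R₀, hR₀1, ?_⟩
  intro σ₁ σ₂ hσ₁ hσ₂ L₁ L₂ s₁ s₂ A₁ A₂ hA₁ hA₂ c m hc0 hc1 hc2 hc3
  choose u₁ hu₁ using hA₁
  choose u₂ hu₂ using hA₂
  have hadm : BilayerChargeAdmissible A₁ A₂ c m := ⟨hc0, hc1, hc2, hc3⟩
  by_cases hres : ∃ i j : ℤ, InResidualClass (A₁ i) (A₂ j) (u₁ i) (u₂ j)
  · exact bilayerWallAt_mono (by linarith) (le_max_right _ _)
      (hC₂ σ₁ σ₂ hσ₁ hσ₂ L₁ L₂ s₁ s₂ A₁ A₂ u₁ u₂ hu₁ hu₂ hres c m hadm)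
  · push Not at hres
    exact bilayerWallAt_mono (by linarith) (le_max_left _ _)
      (hC₁ σ₁ σ₂ hσ₁ hσ₂ L₁ L₂ s₁ s₂ A₁ A₂ u₁ u₂ hu₁ hu₂ (fun i j => hres i j) c m hadm)

/-! ## The family-class dispatcher and the Deficit-MIN pool at one thickness -/

/-- **`stub_famCoaxial` at one `R₀ ≥ 10`** from F-U, (β-iii) and T-F2 at that `R₀` (the dispatchers `onReachCoaxial_of_split` /
`zigCoaxial_of_split`). -/
theorem famCoaxialAt_of_dispatch
    {s₀ : E3} (hs₀ : s₀ ∈ fccSlots) (hcert : ExactOnly 0 (fccSlots.filter fun w => 0 < ⟪w, s₀⟫_ℝ))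
    (hDS : ∀ G₁ G₂ : E3 ≃ₗᵢ[ℝ] E3, DoubleStarCoaxialAt G₁ G₂) (hCP : CapPairCoaxial) {R₀ : ℝ} (h10 : 10 ≤ R₀)
    (hF : ∃ C : ℝ, CoaxialUnifAt C R₀) (hIII : ∃ C : ℝ, BilayerWallBetaIII C R₀)
    (hFault : (∃ C : ℝ, BilayerWallFaultedOnReachCoaxial C R₀) ∧ (∃ C : ℝ, BilayerWallFaultedZigCoaxial C R₀)) :
    (∃ C : ℝ, BilayerWallOnReachCoaxial C R₀) ∧ (∃ C : ℝ, BilayerWallZigCoaxial C R₀) := by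
  obtain ⟨C_F, hFU⟩ := hF
  obtain ⟨C₃, h₃⟩ := hIII
  obtain ⟨⟨C_f, hf⟩, ⟨C_z, hz⟩⟩ := hFault
  exact ⟨⟨_, onReachCoaxial_of_split hs₀ hcert hDS hCP h10 hFU h₃ hf⟩, ⟨_, zigCoaxial_of_split hs₀ hcert hDS hCP h10 hFU h₃ hz⟩⟩

/-- O1/ZO1 (shared frames) at one `R₀` from the coaxial class at that `R₀`. -/
theorem famSharedAt_of_famCoaxialAt {R₀ : ℝ}
    (h : (∃ C : ℝ, BilayerWallOnReachCoaxial C R₀) ∧ (∃ C : ℝ, BilayerWallZigCoaxial C R₀)) :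
    (∃ C : ℝ, BilayerWallOnReachShared C R₀) ∧ (∃ C : ℝ, BilayerWallZigShared C R₀) :=
  ⟨h.1.imp fun _ hC => onReachShared_of_onReachCoaxial hC, h.2.imp fun _ hC => zigShared_of_zigCoaxial hC⟩

/-- O2/ZO2 (twin frames) at one `R₀` from the coaxial class at that `R₀`. -/
theorem famTwinAt_of_famCoaxialAt {R₀ : ℝ}
    (h : (∃ C : ℝ, BilayerWallOnReachCoaxial C R₀) ∧ (∃ C : ℝ, BilayerWallZigCoaxial C R₀)) :
    (∃ C : ℝ, BilayerWallOnReachTwin C R₀) ∧ (∃ C : ℝ, BilayerWallZigTwin C R₀) :=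
  ⟨h.1.imp fun _ hC => onReachTwin_of_onReachCoaxial hC, h.2.imp fun _ hC => zigTwin_of_zigCoaxial hC⟩

/-- **`stub_bilayerWallDeficit` at one `R₀ ≥ 3`** from the h-strip payer pool at that `R₀` (`bilayerWallAt_of_payerBound`). -/
theorem bilayerWallDeficitMinAt_of_pool {R₀ : ℝ} (hR3 : 3 ≤ R₀) (h : ∃ C : ℝ, HStripPayerPool C R₀) :
    ∃ C : ℝ, BilayerWallDeficitMin C R₀ := by
  obtain ⟨C, hpool⟩ := h
  refine ⟨(C + 3456 + 1152 * (R₀ + 1)) / 2, ?_⟩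
  intro σ₁ σ₂ hσ₁ hσ₂ L₁ L₂ s₁ s₂ A₁ A₂ u₁ u₂ hA₁ hA₂ hgen c m hadm hZ hR₁ hR₂ hR₃' hR₄
  exact bilayerWallAt_of_payerBound hσ₁ hσ₂ L₁ L₂ s₁ s₂ R₀ C hR3 c
    (hpool σ₁ σ₂ hσ₁ hσ₂ L₁ L₂ s₁ s₂ A₁ A₂ u₁ u₂ hA₁ hA₂ hgen c m hadm hZ hR₁ hR₂ hR₃' hR₄)

/-! ## The whole v6.20 composition at one thickness -/

/-- **`BilayerWall` from the v6.20 inputs at one `R₀ ≥ 10`**: E1-data (`sE`, `ExactOnly`) and the StarPairFar consequences, F-U,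
(β-iii), T-F2 (both keys), the h-strip payer pool and the residual, all AT `R₀`. -/
theorem bilayerWall_of_stubsAt
    {sE : E3} (hsE : sE ∈ fccSlots) (hcert : ExactOnly 0 (fccSlots.filter fun w => 0 < ⟪w, sE⟫_ℝ))
    (hDS : ∀ F₁ F₂ : E3 ≃ₗᵢ[ℝ] E3, DoubleStarCoaxialAt F₁ F₂) (hCP : CapPairCoaxial) {R₀ : ℝ} (h10 : 10 ≤ R₀)
    (hF : ∃ C : ℝ, CoaxialUnifAt C R₀) (hIII : ∃ C : ℝ, BilayerWallBetaIII C R₀)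
    (hFault : (∃ C : ℝ, BilayerWallFaultedOnReachCoaxial C R₀) ∧ (∃ C : ℝ, BilayerWallFaultedZigCoaxial C R₀))
    (hPool : ∃ C : ℝ, HStripPayerPool C R₀) (hRes : ∃ C : ℝ, BilayerWallResidual C R₀) : BilayerWall := by
  have hR₀6 : 6 ≤ R₀ := by linarith
  have hR₀0 : 0 ≤ R₀ := by linarith
  have hfam := famCoaxialAt_of_dispatch hsE hcert hDS hCP h10 hF hIII hFault
  have hsh := famSharedAt_of_famCoaxialAt hfam
  have htw := famTwinAt_of_famCoaxialAt hfam
  obtain ⟨C_O, hO⟩ := bilayerWallOnReachAll_of_classesAt hsE hcert hDS hCP hR₀6 hsh.1 htw.1 hfam.1 hsh.2 htw.2 hfam.2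
  obtain ⟨C_W, hW⟩ := bilayerWallWalkerCoveredAt_of_F4 hsE hcert hDS hCP hR₀6
  obtain ⟨C_R, hR⟩ := bilayerWallRowCovFrom_framesApart hsE hcert hDS hCP R₀ hR₀6
  obtain ⟨C_D, hD⟩ := bilayerWallDeficitMinAt_of_pool (by linarith) hPool
  obtain ⟨C_X, hX⟩ := hRes
  exact bilayerWall_of_splitAt (by linarith) (bilayerWallGeneric_of_four_minAt hR₀0 hW hR hO hD) hX

end Summit.Ventures.Crystal3D.Cruxes.TextureLiminf.TexShadow

end
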